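import Summits.BirchSwinnertonDyer.BirchSwinnertonDyer.Theorems.GenusKolyvaginAtTwoPowDvdShaCardAtTwoRTGenusKernelTwin
import Literature.NumberTheory.EllipticCurves.QuadraticTwistPadicReduction
import HarnessLib

/-!
# Route `GenusKolyvaginAtTwo`, LINE 18 (L_T `PowDvdShaCardAtTwoRT`, stmt-BirchSwinnertonDyer-23242): THE TWIN'S `Ш` OVER THE
# HEEGNER FIELD IS `Ш(W_K)` — `H¹(K, Wd_K) ≃ H¹(K, W_K)` respecting every local kernel, and the transport of L's two ladders into `Ш(W_K)`

Seat `bsd-line-gk2-p2` g17 (cell `bsd-f1-sign2`), `--supports stmt-BirchSwinnertonDyer-23242` (helper; closes nothing).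
THEOREMS ONLY (no definition, no named fact, no `sorry`); BSD is not proved by any of this.

WHY.  After the death of stub J the Deep regime of LINE 18 is re-cut over `K` (gk2-p4 g17's J′, p698265
`pow_two_mul_dvd_natCard_sha_of_disjoint_ladders`: two DISJOINT ladders INSIDE `Ш(E/F)[2^∞] ≤ H¹(F, E)` of ONE curve give
`2^{2M₀} ∣ #Ш(E/F)[2^∞]`, L_T verbatim for `F = K`, `E = W_K`).  L's ladders live over `ℚ` in TWO curves, `W` and the twin `Wd`;
to feed J′ both must be moved into `H¹(K, W_K)`: the `W`-ladder by restriction (injective on it up to the genus class `x_y`,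
`…RTGenusKernel`), the `Wd`-ladder by restriction (INJECTIVE on the habitat, `…RTGenusKernelTwin`) followed by the twist isomorphism
over `K ∋ √d_K`.  The tree has the twist isomorphism on points / `E[p^∞]` / `E[n]` (`twistGeomPointsEquiv`, `hPsiK`, `hPsiKT`); this
file supplies it on `H¹(K, E)` with all local kernels, hence on `Ш`, and the transport lemmas:

* `exists_twistGalH1Equiv` — for `V` over a field `F ∋ θ₀`, `θ₀² = d ≠ 0` (characteristic `0`): an isomorphism
  `e : H¹(F, V^{(d)}) ≃+ H¹(F, V)` with `c ∈ ker(H¹(F,V^{(d)}) → H¹(E,V^{(d)})) ⟺ e c ∈ ker(H¹(F,V) → H¹(E,V))` for EVERY `F`-field `E`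
  (`h1Equiv` of the `Γ_F`-equivariant `twistGeomPointsEquiv` at `θ = θ₀ ∈ F̄`, local squares `pointsMapOfEmb_twistGeomPointsEquiv`);
  `exists_twistGalH1Equiv_sha` — over a number field: `c ∈ Ш(V^{(d)}) ⟺ e c ∈ Ш(V)`.
* `baseChange_twinModel_eq` — `(Cd • W^{(d)})_K = Cd_K • (W_K)^{(d)}`; **`exists_galH1Equiv_twin_baseChange_sha`** — for `W/ℚ`, `K ∋ θ₀` with
  `θ₀² = d`, `Wd = Cd • W^{(d)}`: `e : H¹(K, Wd_K) ≃+ H¹(K, W_K)` with `Ш(Wd_K) ↔ Ш(W_K)`.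
* `addOrderOf_map_eq_of_injOn_span` / `indep_map_of_injOn_span` — a hom injective on the span of a family preserves `2`-power orders and
  independence; **`transport_ladder_W`** (restriction of a `W`-rung into `Ш(W_K)`, given `ker(res) ∩ span = 0`) and
  **`transport_ladder_twin`** (a `Wd`-rung into `Ш(W_K)` through `res` and `e`, given `Wd.localRestrictionKer K = ⊥` — the habitat case of
  `…RTGenusKernelTwin.localRestrictionKer_twinModel_eq_bot_of_fixed_odd`): the two inputs of J′ in its own currency.

References: [SilvermanAEC2009] X.2 Prop. 2.4, X.§4, X.5 Cor. 5.4; [DokchitserDokchitserAnnals2010] Lemma 4.14; [Kramer1981] §1.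
-/

set_option autoImplicit false
-- the Theorems namespace of this sub repeats the summit name by design (D-0017 nested layout)
set_option linter.dupNamespace false

noncomputable section

open scoped Classical

namespace Summit.BirchSwinnertonDyer.BirchSwinnertonDyer.Theorems.GenusExact.PlusDescent

open Literature.NumberTheory.EllipticCurves WeierstrassCurve

universe u

/-! ## §1 The twist isomorphism on `H¹(F, ·)` over a field containing `√d` -/

section SqrtField

variable {F : Type u} [Field F] [CharZero F] (V : WeierstrassCurve F) {d : F} (hd : d ≠ 0) {θ₀ : F} (hθ₀ : θ₀ ^ 2 = d)

include hd hθ₀ in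
/-- **`H¹(F, V^{(d)}) ≃ H¹(F, V)` respecting every local kernel, when `√d ∈ F`.**  With `θ = θ₀ ∈ F ⊆ F̄` every `σ ∈ Γ_F` fixes `θ`,
so `twistGeomPointsEquiv` is `Γ_F`-equivariant and induces `h1Equiv` on `H¹`; at an `F`-field `E` the local twist isomorphism at
`θ_E = θ₀ ∈ Ē` is `Γ_E`-equivariant and the square along `F̄ → Ē` commutes (`pointsMapOfEmb_twistGeomPointsEquiv`), so local kernels
correspond (`mem_resKer_iff_h1Equiv_mem`). [cite: SilvermanAEC2009, X.5 Cor. 5.4 and X.§4] [cite: DokchitserDokchitserAnnals2010, Lemma 4.14] -/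
theorem exists_twistGalH1Equiv :
    ∃ e : (V.quadraticTwist d).galH1 ≃+ V.galH1,
      ∀ (E : Type u) [Field E] [Algebra F E] (c : (V.quadraticTwist d).galH1),
        c ∈ (V.quadraticTwist d).localRestrictionKer E ↔ e c ∈ V.localRestrictionKer E := by
  haveI : NeZero (2 : F) := ⟨two_ne_zero⟩
  obtain ⟨C, hC⟩ := exists_variableChange_quadraticTwist_one V
  set θ : AlgebraicClosure F := algebraMap F (AlgebraicClosure F) θ₀ with hθdef
  have hθ : θ ^ 2 = algebraMap F (AlgebraicClosure F) d := by rw [hθdef, ← map_pow, hθ₀]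
  have hfix : ∀ σ : Field.absoluteGaloisGroup F, σ • θ = θ := fun σ ↦
    (show AlgebraicClosure F ≃ₐ[F] AlgebraicClosure F from σ).commutes θ₀
  have hsmul : ∀ (σ : Field.absoluteGaloisGroup F) (P : (V.quadraticTwist d).geomPoints),
      twistGeomPointsEquiv V hC hd hθ (σ • P) = σ • twistGeomPointsEquiv V hC hd hθ P :=
    fun σ P ↦ twistGeomPointsEquiv_smul_of_eq V hC hd hθ σ (hfix σ) P
  refine ⟨h1Equiv (twistGeomPointsEquiv V hC hd hθ) hsmul, fun E _ _ c ↦ ?_⟩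
  set θE : AlgebraicClosure E := algebraMap F (AlgebraicClosure E) θ₀ with hθEdef
  have hθE : θE ^ 2 = algebraMap F (AlgebraicClosure E) d := by rw [hθEdef, ← map_pow, hθ₀]
  have hfixE : ∀ τ : Field.absoluteGaloisGroup E, τ • θE = θE := fun τ ↦ by
    rw [hθEdef, IsScalarTower.algebraMap_apply F E (AlgebraicClosure E)]
    exact (show AlgebraicClosure E ≃ₐ[E] AlgebraicClosure E from τ).commutes _
  have hsmulE : ∀ (τ : Field.absoluteGaloisGroup E) (Q : localPoints (V.quadraticTwist d) E),
      twistLocalPointsEquiv V hC hd E hθE (τ • Q) = τ • twistLocalPointsEquiv V hC hd E hθE Q :=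
    fun τ Q ↦ twistLocalPointsEquiv_smul_of_eq V hC hd hθE τ (hfixE τ) Q
  have hι : (closureEmb (K := F) E) θ = θE := by rw [hθdef, hθEdef, AlgHom.commutes]
  exact mem_resKer_iff_h1Equiv_mem (resGal (K := F) E) (pointsMap (V.quadraticTwist d) E)
    (pointsMap_smul (V.quadraticTwist d) E) (pointsMap V E) (pointsMap_smul V E)
    (twistGeomPointsEquiv V hC hd hθ) hsmul (twistLocalPointsEquiv V hC hd E hθE) hsmulE
    (fun P ↦ pointsMapOfEmb_twistGeomPointsEquiv V hC hd hθ (closureEmb (K := F) E) hθE hι P) c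

end SqrtField

section SqrtNumberField

open NumberField IsDedekindDomain

variable {F : Type} [Field F] [NumberField F] (V : WeierstrassCurve F) {d : F} (hd : d ≠ 0) {θ₀ : F} (hθ₀ : θ₀ ^ 2 = d)

include hd hθ₀ in
/-- **`Ш(V^{(d)}/F) ≅ Ш(V/F)` when `√d ∈ F`** (number field `F`): the isomorphism of `exists_twistGalH1Equiv` respects the local kernels at
all finite and infinite places, hence `Ш`. [cite: SilvermanAEC2009, X.§4 and X.5 Cor. 5.4] [cite: DokchitserDokchitserAnnals2010, Lemma 4.14] -/
theorem exists_twistGalH1Equiv_sha :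
    ∃ e : (V.quadraticTwist d).galH1 ≃+ V.galH1, ∀ c : (V.quadraticTwist d).galH1, c ∈ (V.quadraticTwist d).sha ↔ e c ∈ V.sha := by
  obtain ⟨e, he⟩ := exists_twistGalH1Equiv V hd hθ₀
  refine ⟨e, fun c ↦ ?_⟩
  rw [mem_sha_iff, mem_sha_iff]
  exact and_congr (forall_congr' fun v ↦ he _ c) (forall_congr' fun w ↦ he _ c)

end SqrtNumberField

/-! ## §2 The twin over the Heegner field: `H¹(K, Wd_K) ≃ H¹(K, W_K)` with `Ш ↔ Ш` -/

section Twin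

open NumberField IsDedekindDomain

variable (W : WeierstrassCurve ℚ) (K : Type) [Field K] [NumberField K]

/-- `(Cd • W^{(d)})_K = Cd_K • (W_K)^{(d)}` (base change commutes with changes of variables, Mathlib `map_variableChange`, and with the
quadratic twist, tree `map_quadraticTwist`). [cite: SilvermanAEC2009, III.1 Table 3.1 and X.5 Cor. 5.4] -/
theorem baseChange_twinModel_eq (d : ℚ) (Cd : VariableChange ℚ) :
    (Cd • W.quadraticTwist d).baseChange K =
      (Cd.map (algebraMap ℚ K)) • (W.baseChange K).quadraticTwist (algebraMap ℚ K d) := by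
  rw [baseChange, ← map_variableChange, map_quadraticTwist, baseChange]

/-- **`Ш(Wd_K) ≅ Ш(W_K)` for the twin over the Heegner field.**  `W/ℚ`, `K` a number field containing `θ₀` with `θ₀² = d ≠ 0`, and
`Wd = Cd • W^{(d)}` any model of the twist over `ℚ`: there is `e : H¹(K, Wd_K) ≃+ H¹(K, W_K)` with `c ∈ Ш(Wd_K) ⟺ e c ∈ Ш(W_K)`
(change of variables `Cd_K` — tree `galH1Equiv`, `mem_sha_iff_galH1Equiv_mem` — then the twist isomorphism of §1 for `V = W_K`).
[cite: SilvermanAEC2009, X.§4 and X.5 Cor. 5.4] [cite: DokchitserDokchitserAnnals2010, Lemma 4.14] -/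
theorem exists_galH1Equiv_twin_baseChange_sha {d : ℚ} (hd : d ≠ 0) {θ₀ : K} (hθ₀ : θ₀ ^ 2 = algebraMap ℚ K d)
    {Wd : WeierstrassCurve ℚ} (Cd : VariableChange ℚ) (hWd : Cd • W.quadraticTwist d = Wd) :
    ∃ e : (Wd.baseChange K).galH1 ≃+ (W.baseChange K).galH1,
      ∀ c : (Wd.baseChange K).galH1, c ∈ (Wd.baseChange K).sha ↔ e c ∈ (W.baseChange K).sha := by
  -- equal curves have (tautologically) matching `H¹` and `Ш`
  have step₀ : ∀ X Y : WeierstrassCurve K, X = Y → ∃ e : X.galH1 ≃+ Y.galH1, ∀ c, c ∈ X.sha ↔ e c ∈ Y.sha := by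
    rintro X Y rfl
    exact ⟨AddEquiv.refl _, fun c ↦ Iff.rfl⟩
  set X : WeierstrassCurve K := (W.baseChange K).quadraticTwist (algebraMap ℚ K d) with hX
  set C' : VariableChange K := Cd.map (algebraMap ℚ K) with hC'
  have hmodel : Wd.baseChange K = C' • X := by rw [← hWd, baseChange_twinModel_eq W K d Cd]
  obtain ⟨e₀, he₀⟩ := step₀ _ _ hmodel
  have hdK : algebraMap ℚ K d ≠ 0 := by
    rw [Ne, map_eq_zero_iff _ (algebraMap ℚ K).injective]; exact hd
  obtain ⟨e₂, he₂⟩ := exists_twistGalH1Equiv_sha (W.baseChange K) hdK hθ₀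
  refine ⟨(e₀.trans (galH1Equiv X C').symm).trans e₂, fun c ↦ ?_⟩
  rw [AddEquiv.trans_apply, AddEquiv.trans_apply, ← he₂, mem_sha_iff_galH1Equiv_mem X C', AddEquiv.apply_symm_apply]
  exact he₀ c

end Twin

/-! ## §3 Transport of ladder rungs along a homomorphism injective on their span -/

section Transport

variable {A B : Type*} [AddCommGroup A] [AddCommGroup B]

/-- A homomorphism injective on the span of a family of elements of order `2^a` preserves their orders. [folklore] -/
theorem addOrderOf_map_eq_of_injOn_span (f : A →+ B) {n a : ℕ} (x : Fin n → A)
    (hinj : ∀ c : Fin n → ℤ, f (∑ i, c i • x i) = 0 → ∑ i, c i • x i = 0)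
    (hord : ∀ i, addOrderOf (x i) = 2 ^ a) (i : Fin n) : addOrderOf (f (x i)) = 2 ^ a := by
  apply Nat.dvd_antisymm
  · apply addOrderOf_dvd_of_nsmul_eq_zero
    rw [← map_nsmul, ← hord i, addOrderOf_nsmul_eq_zero, map_zero]
  · rw [← hord i]
    apply addOrderOf_dvd_of_nsmul_eq_zero
    -- `(ord f x_i) • x_i = 0` because `f` kills it and `f` is injective on the span
    have hsum : ∑ k, (if k = i then (addOrderOf (f (x i)) : ℤ) else 0) • x k = addOrderOf (f (x i)) • x i := by
      simp only [ite_smul, zero_smul, Finset.sum_ite_eq', Finset.mem_univ, if_true, natCast_zsmul]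
    have h := hinj _ (by rw [hsum, map_nsmul, addOrderOf_nsmul_eq_zero])
    rw [hsum] at h
    exact h

/-- A homomorphism injective on the span of an independent family preserves independence. [folklore] -/
theorem indep_map_of_injOn_span (f : A →+ B) {n a : ℕ} (x : Fin n → A)
    (hinj : ∀ c : Fin n → ℤ, f (∑ i, c i • x i) = 0 → ∑ i, c i • x i = 0)
    (hind : ∀ c : Fin n → ℤ, ∑ i, c i • x i = 0 → ∀ i, ((2 ^ a : ℕ) : ℤ) ∣ c i) :
    ∀ c : Fin n → ℤ, ∑ i, c i • f (x i) = 0 → ∀ i, ((2 ^ a : ℕ) : ℤ) ∣ c i := by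
  intro c hc
  refine hind c (hinj c ?_)
  rw [map_sum]
  simpa only [map_zsmul] using hc

variable (W : WeierstrassCurve ℚ) (K : Type) [Field K] [NumberField K]

/-- **Transport of a `W`-rung into `Ш(W_K)`.**  A rung of the `W`-ladder of L (`n` classes `x_i ∈ H¹(ℚ, W)` of order `2^a`, independent
modulo `2^a`, restricting into `Ш(W_K)`) whose span meets `ker(H¹(ℚ,W) → H¹(K,W_K))` trivially (on the habitat that kernel is `{0, x_y}`,
`…RTGenusKernel.natCard_localRestrictionKer_eq_two`, so the condition is `x_y ∉ span`) restricts to `n` classes of `Ш(W_K) ≤ H¹(K, W_K)` with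
the same orders and independence. [cite: McCallumLMS1991, §5 Thm. 5.4] [cite: Kramer1981, §5 Prop. 8] -/
theorem transport_ladder_W {n a : ℕ} (x : Fin n → W.galH1) (hres : ∀ i, resBaseChange W K (x i) ∈ (W.baseChange K).sha)
    (hord : ∀ i, addOrderOf (x i) = 2 ^ a) (hind : ∀ c : Fin n → ℤ, ∑ i, c i • x i = 0 → ∀ i, ((2 ^ a : ℕ) : ℤ) ∣ c i)
    (hker : ∀ c : Fin n → ℤ, resBaseChange W K (∑ i, c i • x i) = 0 → ∑ i, c i • x i = 0) :
    ∃ u : Fin n → (W.baseChange K).galH1, (∀ i, u i = resBaseChange W K (x i)) ∧ (∀ i, u i ∈ (W.baseChange K).sha) ∧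
      (∀ i, addOrderOf (u i) = 2 ^ a) ∧ ∀ c : Fin n → ℤ, ∑ i, c i • u i = 0 → ∀ i, ((2 ^ a : ℕ) : ℤ) ∣ c i :=
  ⟨fun i ↦ resBaseChange W K (x i), fun _ ↦ rfl, hres, addOrderOf_map_eq_of_injOn_span _ x hker hord,
    indep_map_of_injOn_span _ x hker hind⟩

/-- **Transport of a `Wd`-rung into `Ш(W_K)`.**  `K ∋ θ₀`, `θ₀² = d ≠ 0`, `Wd = Cd • W^{(d)}`; if `H¹(ℚ, Wd) → H¹(K, Wd_K)` is injective
(`Wd.localRestrictionKer K = ⊥` — on the habitat: `…RTGenusKernelTwin.localRestrictionKer_twinModel_eq_bot_of_fixed_odd`), then a rung of the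
`Wd`-ladder of L (`n` classes of order `2^a`, independent, restricting into `Ш(Wd_K)`) is carried by `e ∘ res` (`e : H¹(K, Wd_K) ≃ H¹(K, W_K)` of
`exists_galH1Equiv_twin_baseChange_sha`) to `n` classes of `Ш(W_K) ≤ H¹(K, W_K)` with the same orders and independence — the second input of
J′ (`pow_two_mul_dvd_natCard_sha_of_disjoint_ladders`). [cite: SilvermanAEC2009, X.5 Cor. 5.4] [cite: McCallumLMS1991, §5 Thm. 5.4] -/
theorem transport_ladder_twin {d : ℚ} (hd : d ≠ 0) {θ₀ : K} (hθ₀ : θ₀ ^ 2 = algebraMap ℚ K d)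
    {Wd : WeierstrassCurve ℚ} (Cd : VariableChange ℚ) (hWd : Cd • W.quadraticTwist d = Wd)
    (hbot : Wd.localRestrictionKer K = ⊥) :
    ∃ e : (Wd.baseChange K).galH1 ≃+ (W.baseChange K).galH1,
      (∀ c : (Wd.baseChange K).galH1, c ∈ (Wd.baseChange K).sha ↔ e c ∈ (W.baseChange K).sha) ∧
      ∀ {n a : ℕ} (y : Fin n → Wd.galH1), (∀ i, resBaseChange Wd K (y i) ∈ (Wd.baseChange K).sha) →
        (∀ i, addOrderOf (y i) = 2 ^ a) → (∀ c : Fin n → ℤ, ∑ i, c i • y i = 0 → ∀ i, ((2 ^ a : ℕ) : ℤ) ∣ c i) →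
        (∀ i, e (resBaseChange Wd K (y i)) ∈ (W.baseChange K).sha) ∧
        (∀ i, addOrderOf (e (resBaseChange Wd K (y i))) = 2 ^ a) ∧
        ∀ c : Fin n → ℤ, ∑ i, c i • e (resBaseChange Wd K (y i)) = 0 → ∀ i, ((2 ^ a : ℕ) : ℤ) ∣ c i := by
  obtain ⟨e, he⟩ := exists_galH1Equiv_twin_baseChange_sha W K hd hθ₀ Cd hWd
  refine ⟨e, he, fun {n a} y hres hord hind ↦ ?_⟩
  -- `e ∘ res` is injective on everything: `res` has trivial kernel and `e` is an isomorphism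
  set f : Wd.galH1 →+ (W.baseChange K).galH1 := (e : (Wd.baseChange K).galH1 →+ (W.baseChange K).galH1).comp (resBaseChange Wd K)
    with hf
  have hf_apply : ∀ z, f z = e (resBaseChange Wd K z) := fun _ ↦ rfl
  have hinj : ∀ c : Fin n → ℤ, f (∑ i, c i • y i) = 0 → ∑ i, c i • y i = 0 := by
    intro c hc
    rw [hf_apply, map_eq_zero_iff e e.injective, mem_ker_resBaseChange_iff, hbot, AddSubgroup.mem_bot] at hc
    exact hc
  refine ⟨fun i ↦ (he _).mp (hres i), fun i ↦ ?_, fun c hc ↦ ?_⟩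
  · rw [← hf_apply]; exact addOrderOf_map_eq_of_injOn_span f y hinj hord i
  · exact indep_map_of_injOn_span f y hinj hind c (by simpa only [hf_apply] using hc)

end Transport

end Summit.BirchSwinnertonDyer.BirchSwinnertonDyer.Theorems.GenusExact.PlusDescent

end
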